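import Mathlib
import HarnessLib

/-!
# Theorem β, step B6: the arithmetic of the bi-multilinear slice
(crux `stmt-ValiantsHypothesis-15886`, line `Sketch`, registered stub `stub_betaArithmetic`)

Helper file (`--supports stmt-ValiantsHypothesis-15886`) of line `Sketch` of the crux
`Summit.ValiantsHypothesis.ValiantsHypothesis.Theses.MonotoneRestoration.MonotoneRestorationQP`.
A monotone lower bound gives `2 ^ k ≤ 64 (s + 1) ^ 3 (k + 1) ^ 6` for `k = deg f_n` and
`s =` monotone complexity `≤ (n + 2) ^ c` (and `k ≤ (n + 2) ^ c`); this file converts it into the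
polylog-degree hypothesis `k ≤ (Nat.log 2 n + c') ^ c'` with `c' := 18 c + 15`.

Proof: with `L := Nat.log 2 n` one has `n < 2 ^ (L + 1)`, hence `n + 2 ≤ 2 ^ (L + 2)` and
`(n + 2) ^ c ≤ 2 ^ ((L + 2) c)`; so `s + 1, k + 1 ≤ 2 ^ E` with `E := (L + 2) c + 1`, whence
`2 ^ k ≤ 2 ^ 6 · 2 ^ (3 E) · 2 ^ (6 E) = 2 ^ (9 E + 6)` and `k ≤ 9 E + 6 = 9 c L + 18 c + 15
≤ (L + c') ^ 2 ≤ (L + c') ^ c'`.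
-/

-- `ValiantsHypothesis.ValiantsHypothesis`: the D-0017 layout repeats the problem name in the path.
set_option linter.dupNamespace false

namespace Summit.ValiantsHypothesis.ValiantsHypothesis.Theorems

/-- The exponent extraction: if `s + 1 ≤ 2 ^ E`, `k + 1 ≤ 2 ^ E` and
`2 ^ k ≤ 64 (s + 1) ^ 3 (k + 1) ^ 6`, then `k ≤ 9 E + 6`. [folklore] -/
theorem betaArithmetic_le_of_two_pow_le {s k E : ℕ} (hs : s + 1 ≤ 2 ^ E) (hk : k + 1 ≤ 2 ^ E)
    (h2k : 2 ^ k ≤ 64 * (s + 1) ^ 3 * (k + 1) ^ 6) : k ≤ 9 * E + 6 := by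
  have h3 : (s + 1) ^ 3 ≤ 2 ^ (3 * E) := by
    calc (s + 1) ^ 3 ≤ (2 ^ E) ^ 3 := Nat.pow_le_pow_left hs 3
      _ = 2 ^ (3 * E) := by rw [← pow_mul, mul_comm]
  have h6 : (k + 1) ^ 6 ≤ 2 ^ (6 * E) := by
    calc (k + 1) ^ 6 ≤ (2 ^ E) ^ 6 := Nat.pow_le_pow_left hk 6
      _ = 2 ^ (6 * E) := by rw [← pow_mul, mul_comm]
  have hbound : 2 ^ k ≤ 2 ^ (9 * E + 6) := by
    calc 2 ^ k ≤ 64 * (s + 1) ^ 3 * (k + 1) ^ 6 := h2k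
      _ ≤ 64 * 2 ^ (3 * E) * 2 ^ (6 * E) := Nat.mul_le_mul (Nat.mul_le_mul le_rfl h3) h6
      _ = 2 ^ (9 * E + 6) := by ring
  exact (Nat.pow_le_pow_iff_right Nat.one_lt_two).1 hbound

/-- **B6 — the arithmetic of Theorem β.** `2^k ≤ 64 (s+1)³ (k+1)⁶`, `s ≤ (n+2)^c`, `k ≤ (n+2)^c`
force `k ≤ (log₂ n + c')^c'` for a `c'` depending only on `c` (here `c' := 18 c + 15`).
[folklore] -/
theorem stub_betaArithmetic (c : ℕ) : ∃ c' : ℕ, ∀ n k s : ℕ,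
    s ≤ (n + 2) ^ c → k ≤ (n + 2) ^ c → 2 ^ k ≤ 64 * (s + 1) ^ 3 * (k + 1) ^ 6 →
      k ≤ (Nat.log 2 n + c') ^ c' := by
  refine ⟨18 * c + 15, fun n k s hs hk h2k => ?_⟩
  -- Step 1: `n + 2 ≤ 2 ^ (L + 2)` and `(n + 2) ^ c ≤ 2 ^ ((L + 2) * c)` with `L := Nat.log 2 n`.
  have hn2 : n + 2 ≤ 2 ^ (Nat.log 2 n + 2) := by
    have h : n < 2 ^ (Nat.log 2 n + 1) := Nat.lt_pow_succ_log_self Nat.one_lt_two n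
    have h1 : 1 ≤ 2 ^ (Nat.log 2 n + 1) := Nat.one_le_two_pow
    have h2 : 2 ^ (Nat.log 2 n + 2) = 2 * 2 ^ (Nat.log 2 n + 1) := by rw [pow_succ, mul_comm]
    omega
  have hpow : (n + 2) ^ c ≤ 2 ^ ((Nat.log 2 n + 2) * c) := by
    rw [pow_mul]
    exact Nat.pow_le_pow_left hn2 c
  -- Step 2: `s + 1, k + 1 ≤ 2 ^ E` with `E := (L + 2) * c + 1`, hence `k ≤ 9 * E + 6`.
  have hE1 : 1 ≤ 2 ^ ((Nat.log 2 n + 2) * c) := Nat.one_le_two_pow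
  have hE2 : 2 ^ ((Nat.log 2 n + 2) * c + 1) = 2 * 2 ^ ((Nat.log 2 n + 2) * c) := by
    rw [pow_succ, mul_comm]
  have hs1 : s + 1 ≤ 2 ^ ((Nat.log 2 n + 2) * c + 1) := by omega
  have hk1 : k + 1 ≤ 2 ^ ((Nat.log 2 n + 2) * c + 1) := by omega
  have hkE : k ≤ 9 * ((Nat.log 2 n + 2) * c + 1) + 6 := betaArithmetic_le_of_two_pow_le hs1 hk1 h2k
  -- Step 3: `9 * E + 6 ≤ (L + c') ^ 2 ≤ (L + c') ^ c'`.
  have hsq : 9 * ((Nat.log 2 n + 2) * c + 1) + 6 ≤ (Nat.log 2 n + (18 * c + 15)) ^ 2 := by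
    nlinarith [Nat.zero_le (Nat.log 2 n), Nat.zero_le c, Nat.zero_le (Nat.log 2 n * c)]
  calc k ≤ 9 * ((Nat.log 2 n + 2) * c + 1) + 6 := hkE
    _ ≤ (Nat.log 2 n + (18 * c + 15)) ^ 2 := hsq
    _ ≤ (Nat.log 2 n + (18 * c + 15)) ^ (18 * c + 15) :=
        Nat.pow_le_pow_right (by omega) (by omega)

end Summit.ValiantsHypothesis.ValiantsHypothesis.Theorems
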